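import Summits.CriticalPhenomena.PercolationContinuityZ3.Theorems.PercNearOneGluingNoHeavyLowerTailStarSetPoolTools
import HarnessLib

/-!
# `NoHeavyLowerTail` (stmt-CriticalPhenomena-4575) — demands of the pool entries (U1-PROOF.md §7 "target scaling"; blueprint §F6)

Support file (prover `prim-gen-swap` gen 15; `--supports stmt-CriticalPhenomena-4575`).  No definitions, no named facts, no sorries.

Step 1 of `StarSet.pool_bound` (file `…StarSetPool`): the total weight of the core configurations of a pool entry, in pool units
`E₀ = Π_{V ∉ Pool}(1 − θ_V)`, `t = θ/(1−θ)`, `T = t_{I₀}`: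
* `StarSet.pool_demand_groups` — group entries `(J, X)`: `Σ W ≤ Σ_J Σ_X E₀ t_X t_J (1 + T·[I₀ may ride])`;
* `StarSet.pool_demand_cold` — cold `I₀`-hubs: `Σ W ≤ Σ_X E₀ T t_X`;
* `StarSet.pool_demand_hot` — I-hot bundles: `Σ W ≤ Σ_X E₀ t_X (T + t_D + T t_D)` (three cylinders: `I₀` open / `D` open / both).
-/

namespace Summit.CriticalPhenomena.PercolationContinuityZ3.Theorems

open Finset
open scoped BigOperators

namespace StarSet

variable {ι : Type*} [Fintype ι] [LinearOrder ι]

/-- **Demand of the partner-group entries.** -/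
theorem pool_demand_groups (θ : ι → ℝ) (hθ0 : ∀ k, 0 ≤ θ k) (hθ1 : ∀ k, θ k < 1) (Pool : Finset ι) (I₀ : ι) (hI₀ : I₀ ∉ Pool)
    (Js : Finset ι) (hJs : ∀ J ∈ Js, J ∉ Pool ∧ J ≠ I₀)
    (𝒳 : ι → Finset ι) (h𝒳 : ∀ J ∈ Js, ∀ X ∈ 𝒳 J, X ∉ Pool ∧ X ≠ I₀ ∧ X ≠ J)
    (fl : ι → ι → Prop) [∀ J, DecidablePred (fl J)]
    (Ug : Finset (Finset ι × ι)) (Jof : Finset ι × ι → ι)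
    (hUg : ∀ u ∈ Ug, Jof u ∈ Js ∧ u.2 ∈ 𝒳 (Jof u) ∧ u.2 ∈ u.1 ∧ Jof u ∈ u.1 ∧
      ∀ K ∈ u.1, K ≠ u.2 → K ≠ Jof u → (K ∈ Pool ∨ (fl (Jof u) u.2 ∧ K = I₀))) :
    ∑ u ∈ Ug, ((∏ k ∈ u.1, θ k) * ∏ k ∈ univ \ u.1, (1 - θ k)) ≤
      ∑ J ∈ Js, ∑ X ∈ 𝒳 J, (∏ k ∈ univ \ Pool, (1 - θ k)) *
        (θ X / (1 - θ X) * (θ J / (1 - θ J)) * (1 + if fl J X then θ I₀ / (1 - θ I₀) else 0)) := by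
  classical
  set t : ι → ℝ := fun V => θ V / (1 - θ V) with ht
  set E₀ := ∏ k ∈ univ \ Pool, (1 - θ k) with hE₀
  set W : Finset ι → ℝ := fun S => (∏ k ∈ S, θ k) * ∏ k ∈ univ \ S, (1 - θ k) with hW
  set T := t I₀ with hT
  have ht0 : ∀ V, 0 ≤ t V := fun V => div_nonneg (hθ0 V) (by linarith [hθ1 V])
  -- pool credit with `I₀` allowed: `Π_{V ∉ Pool ∪ {I₀}}(1 − θ) = E₀ (1 + T)`
  have hE₀I : ∏ k ∈ univ \ insert I₀ Pool, (1 - θ k) = E₀ * (1 + T) := by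
    have hsplit : univ \ Pool = insert I₀ (univ \ insert I₀ Pool) := by
      ext k
      simp only [mem_sdiff, mem_univ, true_and, mem_insert]
      constructor
      · intro hk; by_cases h : k = I₀; · exact Or.inl h
        · exact Or.inr (not_or.2 ⟨h, hk⟩)
      · rintro (rfl | hk); · exact hI₀
        · exact fun h => hk (Or.inr h)
    have hnot : I₀ ∉ univ \ insert I₀ Pool := fun h => (mem_sdiff.1 h).2 (mem_insert_self _ _)
    have h1 : 1 - θ I₀ ≠ 0 := by linarith [hθ1 I₀]
    rw [hE₀, hsplit, prod_insert hnot, hT, ht]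
    field_simp
    ring
  set demg : ι → ι → ℝ := fun J X => E₀ * (t X * t J * (1 + if fl J X then T else 0)) with hdemg
  show ∑ u ∈ Ug, W u.1 ≤ ∑ J ∈ Js, ∑ X ∈ 𝒳 J, demg J X
  set Eidx := (Js ×ˢ (univ : Finset ι)).filter (fun p => p.2 ∈ 𝒳 p.1) with hEidx
  have hmaps : ∀ u ∈ Ug, (Jof u, u.2) ∈ Eidx := fun u hu =>
    mem_filter.2 ⟨mem_product.2 ⟨(hUg u hu).1, mem_univ _⟩, (hUg u hu).2.1⟩
  rw [← sum_fiberwise_of_maps_to hmaps]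
  have hE : ∑ J ∈ Js, ∑ X ∈ 𝒳 J, demg J X = ∑ p ∈ Eidx, demg p.1 p.2 :=
    (sum_finset_product (f := fun p : ι × ι => demg p.1 p.2) Eidx Js 𝒳 (fun q => by
      simp only [hEidx, mem_filter, mem_product, mem_univ, and_true])).symm
  rw [hE]
  refine sum_le_sum fun p hp => ?_
  obtain ⟨hp1, hp2⟩ := mem_filter.1 hp
  have hJ : p.1 ∈ Js := (mem_product.1 hp1).1
  obtain ⟨hXP, hXI, hXJ⟩ := h𝒳 p.1 hJ p.2 hp2
  obtain ⟨hJP, hJI⟩ := hJs p.1 hJ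
  -- the allowed rider set
  set Pl := if fl p.1 p.2 then insert I₀ Pool else Pool with hPl
  have hO : Disjoint ({p.2, p.1} : Finset ι) Pl := by
    rw [disjoint_left]
    intro k hk hk'
    rcases mem_insert.1 hk with rfl | hk
    · simp only [hPl] at hk'
      split_ifs at hk' with h
      · rcases mem_insert.1 hk' with h' | h'
        · exact hXI h'
        · exact hXP h'
      · exact hXP hk'
    · rw [mem_singleton.1 hk] at hk'
      simp only [hPl] at hk'
      split_ifs at hk' with h
      · rcases mem_insert.1 hk' with h' | h'
        · exact hJI h'
        · exact hJP h'
      · exact hJP hk'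
  have hle := units_load_le_cylinder_pool θ hθ0 hθ1 Pl {p.2, p.1} hO (Ug.filter (fun u => (Jof u, u.2) = p))
    (fun u hu => by
      obtain ⟨huU, hup⟩ := mem_filter.1 hu
      obtain ⟨-, -, hXS, hJS, hrest⟩ := hUg u huU
      have h2 : u.2 = p.2 := (congrArg Prod.snd hup :)
      have h1 : Jof u = p.1 := (congrArg Prod.fst hup :)
      refine ⟨?_, fun k hk hkO => ?_⟩
      · intro k hk
        rcases mem_insert.1 hk with rfl | hk
        · rw [← h2]; exact hXS
        · rw [mem_singleton.1 hk, ← h1]; exact hJS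
      · have hkX : k ≠ u.2 := fun h => hkO (by rw [h, h2]; exact mem_insert_self _ _)
        have hkJ : k ≠ Jof u := fun h => hkO (by rw [h, h1]; exact mem_insert_of_mem (mem_singleton_self _))
        rcases hrest k hk hkX hkJ with h | ⟨hfl, rfl⟩
        · simp only [hPl]; split_ifs
          · exact mem_insert_of_mem h
          · exact h
        · rw [h1, h2] at hfl
          simp only [hPl, if_pos hfl]
          exact mem_insert_self _ _)
    (fun u hu v hv huv => by
      have h2u : u.2 = p.2 := (congrArg Prod.snd (mem_filter.1 hu).2 :)
      have h2v : v.2 = p.2 := (congrArg Prod.snd (mem_filter.1 hv).2 :)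
      exact Prod.ext huv (h2u.trans h2v.symm))
  refine hle.trans (le_of_eq ?_)
  rw [prod_pair (Ne.symm hXJ).symm]
  simp only [hdemg, hPl]
  split_ifs with h
  · rw [hE₀I]; ring
  · simp only [hE₀]; ring

/-- **Demand of the cold `I₀`-hubs.** -/
theorem pool_demand_cold (θ : ι → ℝ) (hθ0 : ∀ k, 0 ≤ θ k) (hθ1 : ∀ k, θ k < 1) (Pool : Finset ι) (I₀ : ι) (hI₀ : I₀ ∉ Pool)
    (Hc : Finset ι) (hHc : ∀ X ∈ Hc, X ∉ Pool ∧ X ≠ I₀)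
    (Uc : Finset (Finset ι × ι))
    (hUc : ∀ u ∈ Uc, u.2 ∈ Hc ∧ u.2 ∈ u.1 ∧ I₀ ∈ u.1 ∧ ∀ K ∈ u.1, K ≠ u.2 → K ≠ I₀ → K ∈ Pool) :
    ∑ u ∈ Uc, ((∏ k ∈ u.1, θ k) * ∏ k ∈ univ \ u.1, (1 - θ k)) ≤
      ∑ X ∈ Hc, (∏ k ∈ univ \ Pool, (1 - θ k)) * (θ I₀ / (1 - θ I₀) * (θ X / (1 - θ X))) := by
  classical
  set t : ι → ℝ := fun V => θ V / (1 - θ V) with ht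
  set E₀ := ∏ k ∈ univ \ Pool, (1 - θ k) with hE₀
  set W : Finset ι → ℝ := fun S => (∏ k ∈ S, θ k) * ∏ k ∈ univ \ S, (1 - θ k) with hW
  set T := t I₀ with hT
  have ht0 : ∀ V, 0 ≤ t V := fun V => div_nonneg (hθ0 V) (by linarith [hθ1 V])
  show ∑ u ∈ Uc, W u.1 ≤ ∑ X ∈ Hc, E₀ * (T * t X)
  have hmaps : ∀ u ∈ Uc, u.2 ∈ Hc := fun u hu => (hUc u hu).1
  rw [← sum_fiberwise_of_maps_to hmaps]
  refine sum_le_sum fun X hX => ?_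
  obtain ⟨hXP, hXI⟩ := hHc X hX
  have hO : Disjoint ({X, I₀} : Finset ι) Pool := by
    rw [disjoint_left]
    intro k hk hk'
    rcases mem_insert.1 hk with rfl | hk
    · exact hXP hk'
    · rw [mem_singleton.1 hk] at hk'; exact hI₀ hk'
  have hle := units_load_le_cylinder_pool θ hθ0 hθ1 Pool {X, I₀} hO (Uc.filter (fun u => u.2 = X))
    (fun u hu => by
      obtain ⟨huU, huX⟩ := mem_filter.1 hu
      obtain ⟨-, hXS, hIS, hrest⟩ := hUc u huU
      refine ⟨?_, fun k hk hkO => ?_⟩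
      · intro k hk
        rcases mem_insert.1 hk with rfl | hk
        · rw [← huX]; exact hXS
        · rw [mem_singleton.1 hk]; exact hIS
      · have hkX : k ≠ u.2 := fun h => hkO (by rw [h, huX]; exact mem_insert_self _ _)
        have hkI : k ≠ I₀ := fun h => hkO (by rw [h]; exact mem_insert_of_mem (mem_singleton_self _))
        exact hrest k hk hkX hkI)
    (fun u hu v hv huv => Prod.ext huv (((mem_filter.1 hu).2).trans ((mem_filter.1 hv).2).symm))
  refine hle.trans (le_of_eq ?_)
  rw [prod_pair hXI, hT]
  ring

/-- **Demand of the I-hot bundles.** -/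
theorem pool_demand_hot (θ : ι → ℝ) (hθ0 : ∀ k, 0 ≤ θ k) (hθ1 : ∀ k, θ k < 1) (Pool : Finset ι) (I₀ : ι) (hI₀ : I₀ ∉ Pool)
    (Hh : Finset ι) (hHh : ∀ X ∈ Hh, X ∉ Pool ∧ X ≠ I₀)
    (Dh : ι → ι) (hDh : ∀ X ∈ Hh, Dh X ∉ Pool ∧ Dh X ≠ I₀ ∧ Dh X ∉ Hh ∧ Dh X ≠ X ∧ θ X ≤ θ (Dh X) ∧ θ X ≤ θ I₀)
    (Uh : Finset (Finset ι × ι))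
    (hUh : ∀ u ∈ Uh, u.2 ∈ Hh ∧ u.2 ∈ u.1 ∧ (I₀ ∈ u.1 ∨ Dh u.2 ∈ u.1) ∧
      ∀ K ∈ u.1, K ≠ u.2 → K ≠ I₀ → K ≠ Dh u.2 → K ∈ Pool) :
    ∑ u ∈ Uh, ((∏ k ∈ u.1, θ k) * ∏ k ∈ univ \ u.1, (1 - θ k)) ≤
      ∑ X ∈ Hh, (∏ k ∈ univ \ Pool, (1 - θ k)) *
        (θ X / (1 - θ X) * (θ I₀ / (1 - θ I₀) + θ (Dh X) / (1 - θ (Dh X)) + θ I₀ / (1 - θ I₀) * (θ (Dh X) / (1 - θ (Dh X))))) := by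
  classical
  set t : ι → ℝ := fun V => θ V / (1 - θ V) with ht
  set E₀ := ∏ k ∈ univ \ Pool, (1 - θ k) with hE₀
  set W : Finset ι → ℝ := fun S => (∏ k ∈ S, θ k) * ∏ k ∈ univ \ S, (1 - θ k) with hW
  set T := t I₀ with hT
  have ht0 : ∀ V, 0 ≤ t V := fun V => div_nonneg (hθ0 V) (by linarith [hθ1 V])
  show ∑ u ∈ Uh, W u.1 ≤ ∑ X ∈ Hh, E₀ * (t X * (T + t (Dh X) + T * t (Dh X)))
  have hmaps : ∀ u ∈ Uh, u.2 ∈ Hh := fun u hu => (hUh u hu).1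
  rw [← sum_fiberwise_of_maps_to hmaps]
  refine sum_le_sum fun X hX => ?_
  obtain ⟨hXP, hXI⟩ := hHh X hX
  obtain ⟨hDP, hDI, -, hDX, -, -⟩ := hDh X hX
  set UX := Uh.filter (fun u => u.2 = X) with hUX
  -- split by which of `I₀`, `Dh X` are open
  set U1 := UX.filter (fun u => Dh X ∉ u.1) with hU1
  set U2 := (UX.filter (fun u => Dh X ∈ u.1)).filter (fun u => I₀ ∉ u.1) with hU2
  set U3 := (UX.filter (fun u => Dh X ∈ u.1)).filter (fun u => I₀ ∈ u.1) with hU3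
  have hsplit : ∑ u ∈ UX, W u.1 = ∑ u ∈ U1, W u.1 + ∑ u ∈ U2, W u.1 + ∑ u ∈ U3, W u.1 := by
    rw [← sum_filter_add_sum_filter_not UX (fun u => Dh X ∉ u.1)]
    have h2 : UX.filter (fun u => ¬ (Dh X ∉ u.1)) = UX.filter (fun u => Dh X ∈ u.1) :=
      filter_congr fun u _ => not_not
    rw [h2, ← sum_filter_add_sum_filter_not (UX.filter (fun u => Dh X ∈ u.1)) (fun u => I₀ ∉ u.1)]
    have h3 : (UX.filter (fun u => Dh X ∈ u.1)).filter (fun u => ¬ (I₀ ∉ u.1)) = U3 :=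
      filter_congr fun u _ => not_not
    rw [h3, add_assoc]
  have hinjX : ∀ U' ⊆ UX, ∀ u ∈ U', ∀ v ∈ U', u.1 = v.1 → u = v := fun U' hU' u hu v hv huv =>
    Prod.ext huv (((mem_filter.1 (hU' hu)).2).trans ((mem_filter.1 (hU' hv)).2).symm)
  have hU1sub : U1 ⊆ UX := filter_subset _ _
  have hU2sub : U2 ⊆ UX := (filter_subset _ _).trans (filter_subset _ _)
  have hU3sub : U3 ⊆ UX := (filter_subset _ _).trans (filter_subset _ _)
  -- U1: `I₀` open, `Dh X` closed
  have h1 : ∑ u ∈ U1, W u.1 ≤ E₀ * (t X * T) := by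
    have hO : Disjoint ({X, I₀} : Finset ι) Pool := by
      rw [disjoint_left]
      intro k hk hk'
      rcases mem_insert.1 hk with rfl | hk
      · exact hXP hk'
      · rw [mem_singleton.1 hk] at hk'; exact hI₀ hk'
    have hle := units_load_le_cylinder_pool θ hθ0 hθ1 Pool {X, I₀} hO U1
      (fun u hu => by
        obtain ⟨huX', hDu⟩ := mem_filter.1 hu
        obtain ⟨huU, huX⟩ := mem_filter.1 huX'
        obtain ⟨-, hXS, hor, hrest⟩ := hUh u huU
        have hIS : I₀ ∈ u.1 := by
          rcases hor with h | h
          · exact h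
          · rw [huX] at h; exact absurd h hDu
        refine ⟨?_, fun k hk hkO => ?_⟩
        · intro k hk
          rcases mem_insert.1 hk with rfl | hk
          · rw [← huX]; exact hXS
          · rw [mem_singleton.1 hk]; exact hIS
        · have hkX : k ≠ u.2 := fun h => hkO (by rw [h, huX]; exact mem_insert_self _ _)
          have hkI : k ≠ I₀ := fun h => hkO (by rw [h]; exact mem_insert_of_mem (mem_singleton_self _))
          have hkD : k ≠ Dh u.2 := fun h => hDu (by rw [← huX, ← h]; exact hk)
          exact hrest k hk hkX hkI hkD)
      (hinjX U1 hU1sub)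
    refine hle.trans (le_of_eq ?_)
    rw [prod_pair hXI, hT]
  -- U2: `Dh X` open, `I₀` closed
  have h2 : ∑ u ∈ U2, W u.1 ≤ E₀ * (t X * t (Dh X)) := by
    have hO : Disjoint ({X, Dh X} : Finset ι) Pool := by
      rw [disjoint_left]
      intro k hk hk'
      rcases mem_insert.1 hk with rfl | hk
      · exact hXP hk'
      · rw [mem_singleton.1 hk] at hk'; exact hDP hk'
    have hle := units_load_le_cylinder_pool θ hθ0 hθ1 Pool {X, Dh X} hO U2
      (fun u hu => by
        obtain ⟨hu', hIu⟩ := mem_filter.1 hu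
        obtain ⟨huX', hDu⟩ := mem_filter.1 hu'
        obtain ⟨huU, huX⟩ := mem_filter.1 huX'
        obtain ⟨-, hXS, -, hrest⟩ := hUh u huU
        refine ⟨?_, fun k hk hkO => ?_⟩
        · intro k hk
          rcases mem_insert.1 hk with rfl | hk
          · rw [← huX]; exact hXS
          · rw [mem_singleton.1 hk]; exact hDu
        · have hkX : k ≠ u.2 := fun h => hkO (by rw [h, huX]; exact mem_insert_self _ _)
          have hkI : k ≠ I₀ := fun h => hIu (h ▸ hk)
          have hkD : k ≠ Dh u.2 := fun h => hkO (by rw [h, huX]; exact mem_insert_of_mem (mem_singleton_self _))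
          exact hrest k hk hkX hkI hkD)
      (hinjX U2 hU2sub)
    refine hle.trans (le_of_eq ?_)
    rw [prod_pair hDX.symm]
  -- U3: both open
  have h3 : ∑ u ∈ U3, W u.1 ≤ E₀ * (t X * T * t (Dh X)) := by
    have hO : Disjoint ({X, I₀, Dh X} : Finset ι) Pool := by
      rw [disjoint_left]
      intro k hk hk'
      rcases mem_insert.1 hk with rfl | hk
      · exact hXP hk'
      rcases mem_insert.1 hk with rfl | hk
      · exact hI₀ hk'
      · rw [mem_singleton.1 hk] at hk'; exact hDP hk'
    have hle := units_load_le_cylinder_pool θ hθ0 hθ1 Pool {X, I₀, Dh X} hO U3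
      (fun u hu => by
        obtain ⟨hu', hIu⟩ := mem_filter.1 hu
        obtain ⟨huX', hDu⟩ := mem_filter.1 hu'
        obtain ⟨huU, huX⟩ := mem_filter.1 huX'
        obtain ⟨-, hXS, -, hrest⟩ := hUh u huU
        refine ⟨?_, fun k hk hkO => ?_⟩
        · intro k hk
          rcases mem_insert.1 hk with rfl | hk
          · rw [← huX]; exact hXS
          rcases mem_insert.1 hk with rfl | hk
          · exact hIu
          · rw [mem_singleton.1 hk]; exact hDu
        · have hkX : k ≠ u.2 := fun h => hkO (by rw [h, huX]; exact mem_insert_self _ _)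
          have hkI : k ≠ I₀ := fun h => hkO (by rw [h]; exact mem_insert_of_mem (mem_insert_self _ _))
          have hkD : k ≠ Dh u.2 := fun h =>
            hkO (by rw [h, huX]; exact mem_insert_of_mem (mem_insert_of_mem (mem_singleton_self _)))
          exact hrest k hk hkX hkI hkD)
      (hinjX U3 hU3sub)
    refine hle.trans (le_of_eq ?_)
    have hXnot : X ∉ ({I₀, Dh X} : Finset ι) := by
      intro h
      rcases mem_insert.1 h with h | h
      · exact hXI h
      · exact hDX.symm (mem_singleton.1 h)
    rw [prod_insert hXnot, prod_pair hDI.symm, hT]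
    ring
  rw [hsplit]
  have htX := ht0 X
  have htD := ht0 (Dh X)
  nlinarith [h1, h2, h3]

end StarSet

end Summit.CriticalPhenomena.PercolationContinuityZ3.Theorems
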